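import Literature.AlgebraicGeometry.AbelianSchemes.PolarizedTupleIsomPiecesOfAtlas        -- ★ (b0″) A-p14 `exists_isomPieces_of_forall_exists_chart'`
import Literature.AlgebraicGeometry.AbelianSchemes.PolarizedTupleToProjChart            -- ★ (b1′) A-p14 `exists_toProj_chart_of_relEmb` (+ ★ (b5) REL-EMB-SPREAD′, ★ (b3))
import Literature.AlgebraicGeometry.Modules.SerreTwistModProjectiveSpaceOverAffine      -- ★ (b1) LA4-p03 `exists_isClosedImmersion_projectiveSpace_fin_of_PP`
import HarnessLib

/-!
# The `hpieces` input of the cofinite injectivity passage for ONE polarised tuple over a Noetherian stage: finitely many finite-type pieces cover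
# the iso-locus over `𝒱 ×_B 𝒱` for an open `𝒱` off finitely many primes (organ (GS-3b) ASSEMBLY of the `stub_INJ0` payer)

Topic `AlgebraicGeometry/AbelianSchemes`; namespace `Literature.AlgebraicGeometry.AbelianSchemes.AbelianSchemeOver`.  THEOREMS ONLY (no definition, no instance,
no notation, no named fact, no `sorry`); universe `Scheme.{0}` (the SP3-a2 ∕ (G2) universe).  Cell `hodgecm-mathlib` (D-0151), P6 «MOD programme» (crux hLiu418 =
stmt-HodgeConjecture-24832, `--supports`, count-neutral); P-LINE ED. 2 leaf `Lines/F0_P6a_PELSpread.lean`, socket `stub_INJ0` (LEAD F0P6-plan (g3) «M-55b» (2)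
STAGE CUT; A-p14 (g35) handoff dossier `HANDOFF-stubINJ0.A-p14g35.final.md` step 1; LA4-plan (g0) DEAL v3 «LA4-p03 = INJ0 ASSEMBLY OWNER»).  HC_CM is proved only
modulo the printed citations until rung 0 closes; nothing here is about HC.

THE MATHEMATICS ([MumfordFogartyKirwan1994] Ch. 6 §2 Prop. 6.10 (`L^Δ(λ)^{⊗3}` relatively very ample), Ch. 7 §2 Prop. 7.3 (the `Isom`-scheme of two
polarised tuples is of finite type); [EGAIII1] (4.7.1); [Hartshorne1977] II Thm. 7.1, II Prop. 5.12 (c); [GortzWedhorn2020] (4.12)).  Let `T` be a Noetherian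
scheme of finite type over a Dedekind domain `B` of characteristic `0`, `(𝒜, ι, (Â, 𝒫), λ, φ)` a PEL tuple over `T` with the graph `Gr = (1, λ)` and a rank-one frame
system of the Mumford bundle `L^Δ(λ)^{⊗3} = Gr^*𝒫^{⊗3}`.  ★ REL-EMB-SPREAD′ (`PolarizedAbelianSchemeLocalEmbedding`, [MFK] 6.10 + [EGAIII1] 4.7.1) gives an open
`𝒱 ⊆ T` containing the generic fibre, off finitely many primes of `B`, covered by affine Noetherian charts `ι : Spec R ↪ 𝒱` over which `L^Δ(λ)^{⊗3}` embeds
`𝒜 ×_T Spec R ↪ ℙ^m_R` ([Hartshorne1977] II 7.1; ★ (b1′) `PolarizedTupleToProjChart`); ★ `Modules/SerreTwistModProjectiveSpaceOverAffine` ((b1), [GortzWedhorn2020] (4.12))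
reads this as an (I-EMB) datum into `𝐏(Fin m; Spec R)`, ★ `Modules/SerreTwistModCoordinatePadding` ((b2′)) pads it to `𝐏(Fin (m+1); Spec R)`, ★ `TupleRelCancel` +
★ (b3) `PolarizedTupleEmbeddingBaseChange` move it from `𝒜 ×_T Spec R` to the iterated pull-back `(𝒜|_𝒱) ×_𝒱 Spec R`, and ★ (b0″)
`PolarizedTupleIsomPiecesOfAtlas.exists_isomPieces_of_forall_exists_chart'` ([MFK] 7.3 over the Segre-embedded product charts) turns the resulting atlas of the
compact `𝒱` into the `hpieces` clause of ★ (GS-3) `TupleIsoSpecialInjectivityOfGeneric.exists_finset_forall_eq_of_tupleIsoAt` for the restricted tuple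
`(𝒜|_𝒱, …)` over `𝒱 → Spec B`.  Everything here is ASSEMBLY of landed organs; no new mathematics.

* `exists_opens_isomPieces_of_frameSystem` — THE HEAD: `∃ 𝒱`, `q(T ∖ 𝒱)` finite, `𝒱 ⊇` the generic fibre, and `hpieces` for `(𝒜.baseChange 𝒱.ι, …)` over `𝒱.ι ≫ q`
  (the binder of ★ (GS-3), token for token with `q ↦ 𝒱.ι ≫ q`, tuple `↦` its base change along `𝒱.ι`).
* ED. 2 (add-only): `exists_opens_isomPieces` — the same from the TUPLE ALONE (the graph `(1, λ)` and a rank-one frame system of `L^Δ(λ)^{⊗3}` always exist: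
  ★ `Modules.hasRank_pullback`, ★ `hasRank_tensorPow_one`, ★ `exists_frameSystem_of_hasRank`).

## References
* [MumfordFogartyKirwan1994] D. Mumford, J. Fogarty, F. Kirwan, *Geometric Invariant Theory*, 3rd ed. (1994), Ch. 6 §2 Prop. 6.10 (p. 121); Ch. 7 §2 Prop. 7.3 (p. 132).
* [EGAIII1] A. Grothendieck, *EGA III₁* (1961), (4.7.1).
* [Hartshorne1977] R. Hartshorne, *Algebraic Geometry* (1977), II Thm. 7.1, II Prop. 5.12 (c).
* [GortzWedhorn2020] U. Görtz, T. Wedhorn, *Algebraic Geometry I*, 2nd ed. (2020), Section (4.12) (p. 113).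
-/

set_option autoImplicit false

noncomputable section

-- Mathlib's `Over`/pull-back API is stated across semireducible wrappers (as in the ★ `AbelianSchemes/*` files).
set_option backward.isDefEq.respectTransparency false

open CategoryTheory CategoryTheory.Limits AlgebraicGeometry

namespace Literature.AlgebraicGeometry.AbelianSchemes

namespace AbelianSchemeOver

open Literature.AlgebraicGeometry Literature.AlgebraicGeometry.Morphisms
open Literature.AlgebraicGeometry.Motives Literature.AlgebraicGeometry.Modules Literature.AlgebraicGeometry.Modules.SerreTwist
open Literature.AlgebraicGeometry.AbelianVarieties

/-- **THE `hpieces` INPUT FOR THE STAGE TUPLE (assembly).**  For a Noetherian `T` of finite type over a Dedekind domain `B` of characteristic `0` and a PEL tuple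
`(𝒜, ρ, D, pol, lvl)` over `T` with graph `Gr = (1, λ)` and a rank-one frame system of `L^Δ(λ)^{⊗3}`: there is an open `𝒱 ⊆ T` with `q(T ∖ 𝒱)` finite and
`𝒱 ⊇` the generic fibre such that the iso-locus of the restricted tuple `(𝒜|_𝒱, …)` at pairs of points with the same image in `Spec B` is covered exactly by finitely
many quasi-compact finite-type pieces over `𝒱 ×_B 𝒱` — the `hpieces` binder of ★ (GS-3) `exists_finset_forall_eq_of_tupleIsoAt` for `q := 𝒱.ι ≫ q`.
Assembly: ★ REL-EMB-SPREAD′ charts ⇒ ★ (b1′) `toProj` embedding ⇒ ★ (b1) (I-EMB) over `Spec R` ⇒ ★ (b2′) padding ⇒ ★ `TupleRelCancel` + ★ (b3) transport to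
`(𝒜|_𝒱) ×_𝒱 Spec R` ⇒ ★ (b0″) atlas of the compact `𝒱`. [cite: MumfordFogartyKirwan1994, Ch. 6 §2 Prop. 6.10 (p. 121); Ch. 7 §2 Prop. 7.3 (p. 132)]
[cite: EGAIII1, (4.7.1)] [cite: Hartshorne1977, II Thm. 7.1 and II Prop. 5.12 (c)] [cite: GortzWedhorn2020, Section (4.12) (p. 113)] -/
theorem exists_opens_isomPieces_of_frameSystem
    {B : Type} [CommRing B] [IsDedekindDomain B] [CharZero B] {T : Scheme.{0}} [IsNoetherian T]
    (q : T ⟶ Spec (.of B)) [LocallyOfFiniteType q] {O : Type} [CommRing O]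
    (𝒜 : AbelianSchemeOver T) (ρ : RingAction O 𝒜) (D : 𝒜.DualPair) (pol : 𝒜.Polarization D) {g N : ℕ} (lvl : 𝒜.LevelStructure g N)
    (Gr : 𝒜.X.left ⟶ 𝒜.prodLeft D.hat) (hGr₁ : Gr ≫ pullback.fst 𝒜.X.hom D.hat.X.hom = 𝟙 _)
    (hGr₂ : Gr ≫ pullback.snd 𝒜.X.hom D.hat.X.hom = pol.lam.left)
    (F : FrameSystem (tensorPow ((Scheme.Modules.pullback Gr).obj D.P) 3)) (h1 : ∀ x, F.rank x = 1) :
    ∃ 𝒱 : T.Opens, (q '' ((𝒱 : Set T)ᶜ)).Finite ∧ (∀ t : T, (q t).asIdeal = ⊥ → t ∈ 𝒱) ∧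
    ∃ (r : ℕ) (I : Fin r → Scheme.{0}) (f : ∀ i, I i ⟶ pullback (𝒱.ι ≫ q) (𝒱.ι ≫ q)) (_ : ∀ i, QuasiCompact (f i))
      (_ : ∀ i, LocallyOfFiniteType (f i)),
      ∀ ⦃Ω : Type⦄ [Field Ω] [IsAlgClosed Ω] (t : Spec (CommRingCat.of Ω) ⟶ pullback (𝒱.ι ≫ q) (𝒱.ι ≫ q)),
        (∃ (G : (((𝒜.baseChange 𝒱.ι).baseChange (pullback.fst (𝒱.ι ≫ q) (𝒱.ι ≫ q))).baseChange t).X.left ⟶ (((𝒜.baseChange 𝒱.ι).baseChange (pullback.snd (𝒱.ι ≫ q) (𝒱.ι ≫ q))).baseChange t).X.left)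
            (Ĝ : (((D.baseChange 𝒱.ι).baseChange (pullback.fst (𝒱.ι ≫ q) (𝒱.ι ≫ q))).baseChange t).hat.X.left ⟶ (((D.baseChange 𝒱.ι).baseChange (pullback.snd (𝒱.ι ≫ q) (𝒱.ι ≫ q))).baseChange t).hat.X.left),
          (((lvl.baseChange 𝒱.ι).baseChange (pullback.fst (𝒱.ι ≫ q) (𝒱.ι ≫ q))).baseChange t).IsBaseChangeVia (((lvl.baseChange 𝒱.ι).baseChange (pullback.snd (𝒱.ι ≫ q) (𝒱.ι ≫ q))).baseChange t)
              (𝟙 (Spec (CommRingCat.of Ω))) G ∧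
          (((D.baseChange 𝒱.ι).baseChange (pullback.fst (𝒱.ι ≫ q) (𝒱.ι ≫ q))).baseChange t).hat.IsBaseChangeVia (((D.baseChange 𝒱.ι).baseChange (pullback.snd (𝒱.ι ≫ q) (𝒱.ι ≫ q))).baseChange t).hat
              (𝟙 (Spec (CommRingCat.of Ω))) Ĝ ∧
          (∃ (wG : (((𝒜.baseChange 𝒱.ι).baseChange (pullback.fst (𝒱.ι ≫ q) (𝒱.ι ≫ q))).baseChange t).X.hom ≫ 𝟙 (Spec (CommRingCat.of Ω)) =
                G ≫ (((𝒜.baseChange 𝒱.ι).baseChange (pullback.snd (𝒱.ι ≫ q) (𝒱.ι ≫ q))).baseChange t).X.hom)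
              (wĜ : (((D.baseChange 𝒱.ι).baseChange (pullback.fst (𝒱.ι ≫ q) (𝒱.ι ≫ q))).baseChange t).hat.X.hom ≫ 𝟙 (Spec (CommRingCat.of Ω)) =
                Ĝ ≫ (((D.baseChange 𝒱.ι).baseChange (pullback.snd (𝒱.ι ≫ q) (𝒱.ι ≫ q))).baseChange t).hat.X.hom),
            Nonempty ((Scheme.Modules.pullback
              (pullback.map (((𝒜.baseChange 𝒱.ι).baseChange (pullback.fst (𝒱.ι ≫ q) (𝒱.ι ≫ q))).baseChange t).X.hom (((D.baseChange 𝒱.ι).baseChange (pullback.fst (𝒱.ι ≫ q) (𝒱.ι ≫ q))).baseChange t).hat.X.hom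
                (((𝒜.baseChange 𝒱.ι).baseChange (pullback.snd (𝒱.ι ≫ q) (𝒱.ι ≫ q))).baseChange t).X.hom (((D.baseChange 𝒱.ι).baseChange (pullback.snd (𝒱.ι ≫ q) (𝒱.ι ≫ q))).baseChange t).hat.X.hom
                G Ĝ (𝟙 (Spec (CommRingCat.of Ω))) wG wĜ)).obj (((D.baseChange 𝒱.ι).baseChange (pullback.snd (𝒱.ι ≫ q) (𝒱.ι ≫ q))).baseChange t).P ≅
              (((D.baseChange 𝒱.ι).baseChange (pullback.fst (𝒱.ι ≫ q) (𝒱.ι ≫ q))).baseChange t).P)) ∧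
          (((pol.baseChange 𝒱.ι).baseChange (pullback.fst (𝒱.ι ≫ q) (𝒱.ι ≫ q))).baseChange t).lam.left ≫ Ĝ = G ≫ (((pol.baseChange 𝒱.ι).baseChange (pullback.snd (𝒱.ι ≫ q) (𝒱.ι ≫ q))).baseChange t).lam.left ∧
          ∀ a : O, (baseChangeHom (((ρ.baseChange 𝒱.ι).baseChange (pullback.fst (𝒱.ι ≫ q) (𝒱.ι ≫ q))).i a) t).left ≫ G =
            G ≫ (baseChangeHom (((ρ.baseChange 𝒱.ι).baseChange (pullback.snd (𝒱.ι ≫ q) (𝒱.ι ≫ q))).i a) t).left) ↔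
        ∃ (i : Fin r) (s : Spec (CommRingCat.of Ω) ⟶ I i), s ≫ f i = t := by
  classical
  -- the open `𝒱` and its affine charts (★ REL-EMB-SPREAD′)
  obtain ⟨𝒱, hfin, hgen, hchart⟩ :=
    exists_opens_finite_image_compl_forall_affineOpen_isClosedImmersion_toProj' q 𝒜 D pol Gr hGr₁ hGr₂ F h1
  refine ⟨𝒱, hfin, hgen, ?_⟩
  -- the restricted base is compact (Noetherian) and of finite type over `B`
  haveI : TopologicalSpace.NoetherianSpace ↥(𝒱 : Scheme.{0}) := TopologicalSpace.NoetherianSpace.set (𝒱 : Set ↥T)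
  haveI : CompactSpace ↥(𝒱 : Scheme.{0}) := inferInstance
  haveI : QuasiCompact (𝒱.ι ≫ q) := inferInstance
  haveI : LocallyOfFiniteType (𝒱.ι ≫ q) := inferInstance
  refine exists_isomPieces_of_forall_exists_chart' (𝒱.ι ≫ q) (𝒜.baseChange 𝒱.ι) (ρ.baseChange 𝒱.ι) (D.baseChange 𝒱.ι)
    (pol.baseChange 𝒱.ι) (lvl.baseChange 𝒱.ι) (k := 3) fun y => ?_
  -- the chart through `y`
  have hy𝒱 : (𝒱.ι.base y : T) ∈ 𝒱 := by simp
  obtain ⟨R, instR, instN, ι, instι, hyι, hι𝒱, hemb⟩ := hchart _ hy𝒱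
  -- lift the chart into `𝒱`
  have hrange : Set.range ι.base ⊆ Set.range 𝒱.ι.base := by rwa [Scheme.Opens.range_ι]
  let c : Spec (.of R) ⟶ (𝒱 : Scheme.{0}) := IsOpenImmersion.lift 𝒱.ι ι hrange
  have hc : c ≫ 𝒱.ι = ι := IsOpenImmersion.lift_fac 𝒱.ι ι hrange
  haveI : IsOpenImmersion (c ≫ 𝒱.ι) := by rw [hc]; infer_instance
  haveI : IsOpenImmersion c := IsOpenImmersion.of_comp c 𝒱.ι
  haveI : IsNoetherian (Spec (.of R)) := inferInstance
  letI : Algebra intU.{0} R := ((Int.castRingHom R).comp ULift.ringEquiv.toRingHom).toAlgebra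
  have hyc : y ∈ Set.range c.base := by
    obtain ⟨z, hz⟩ := hyι
    refine ⟨z, 𝒱.ι.isOpenEmbedding.injective ?_⟩
    have h' : (c ≫ 𝒱.ι).base z = 𝒱.ι.base (c.base z) := by rw [Scheme.Hom.comp_base]; rfl
    rw [← h', hc]
    exact hz
  -- the (I-EMB) datum of `𝒜 ×_T Spec R` over `Spec R`: ★ (b1′) + ★ (b1) + ★ (b2′)
  obtain ⟨Gr₀, m, φ, hGr₀₁, hGr₀₂, hφ, hφc, ⟨e₀⟩⟩ := exists_toProj_chart_of_relEmb 𝒜 D pol Gr hGr₁ hGr₂ F h1 ι hemb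
  obtain ⟨j₀, hj₀, hj₀c, hj₀e⟩ := exists_isClosedImmersion_projectiveSpace_fin_of_PP (𝒜.baseChange ι).X.hom φ hφ
  obtain ⟨ψ₀⟩ := hj₀e (unitModule _) 1
  obtain ⟨j₁, hj₁, hj₁c, hj₁e⟩ := exists_isClosedImmersion_pad (Nat.le_succ m) (𝒜.baseChange ι).X.hom j₀ hj₀
  obtain ⟨ψ₁⟩ := hj₁e (unitModule _) 1
  -- transport to the iterated pull-back `(𝒜|_𝒱) ×_𝒱 Spec R` along the canonical relation (★ `TupleRelCancel` + ★ (b3))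
  obtain ⟨H, Ĥ, hlvl, -, ⟨wG, wĜ, hP⟩, hlam, -⟩ :=
    exists_tupleRel_baseChange_baseChange_of_comp_eq 𝒜 ρ D pol lvl 𝒱.ι c ι hc
  obtain ⟨Gr', j', hGr'₁, hGr'₂, hj', hj'c, he'⟩ := exists_iemb_of_tupleRel (𝟙 (Spec (.of R))) (D.baseChange ι)
    ((D.baseChange 𝒱.ι).baseChange c) (pol.baseChange ι).lam ((pol.baseChange 𝒱.ι).baseChange c).lam hlvl.1 wG wĜ hP hlam
    Gr₀ hGr₀₁ hGr₀₂ j₁ hj₁ (ψ₁ ≪≫ ψ₀ ≪≫ e₀)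
  exact ⟨Spec (.of R), inferInstance, c, inferInstance, hyc, m, Gr', j', hGr'₁, hGr'₂, hj', hj'c, he'⟩

/-! ### ED. 2 (add-only): the frame-free head -/

/-- **THE `hpieces` INPUT FOR THE STAGE TUPLE, FROM THE TUPLE ALONE** (ED. 2): as `exists_opens_isomPieces_of_frameSystem`, with the graph `Gr := (1, λ)`
(`pullback.lift`) and a rank-one frame system of `L^Δ(λ)^{⊗3} = Gr^*𝒫^{⊗3}` supplied internally (`𝒫` is a line bundle, ★ `hasRank_pullback`, ★
`hasRank_tensorPow_one`, ★ `exists_frameSystem_of_hasRank`) — so the `stub_INJ0` zip feeds a by-value stage tuple and nothing else.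
[cite: MumfordFogartyKirwan1994, Ch. 6 §2 Prop. 6.10 (p. 121); Ch. 7 §2 Prop. 7.3 (p. 132)] [cite: EGAIII1, (4.7.1)] [cite: Hartshorne1977, II Thm. 7.1 and II Prop. 5.12 (c)] -/
theorem exists_opens_isomPieces
    {B : Type} [CommRing B] [IsDedekindDomain B] [CharZero B] {T : Scheme.{0}} [IsNoetherian T]
    (q : T ⟶ Spec (.of B)) [LocallyOfFiniteType q] {O : Type} [CommRing O]
    (𝒜 : AbelianSchemeOver T) (ρ : RingAction O 𝒜) (D : 𝒜.DualPair) (pol : 𝒜.Polarization D) {g N : ℕ} (lvl : 𝒜.LevelStructure g N) :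
    ∃ 𝒱 : T.Opens, (q '' ((𝒱 : Set T)ᶜ)).Finite ∧ (∀ t : T, (q t).asIdeal = ⊥ → t ∈ 𝒱) ∧
    ∃ (r : ℕ) (I : Fin r → Scheme.{0}) (f : ∀ i, I i ⟶ pullback (𝒱.ι ≫ q) (𝒱.ι ≫ q)) (_ : ∀ i, QuasiCompact (f i))
      (_ : ∀ i, LocallyOfFiniteType (f i)),
      ∀ ⦃Ω : Type⦄ [Field Ω] [IsAlgClosed Ω] (t : Spec (CommRingCat.of Ω) ⟶ pullback (𝒱.ι ≫ q) (𝒱.ι ≫ q)),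
        (∃ (G : (((𝒜.baseChange 𝒱.ι).baseChange (pullback.fst (𝒱.ι ≫ q) (𝒱.ι ≫ q))).baseChange t).X.left ⟶ (((𝒜.baseChange 𝒱.ι).baseChange (pullback.snd (𝒱.ι ≫ q) (𝒱.ι ≫ q))).baseChange t).X.left)
            (Ĝ : (((D.baseChange 𝒱.ι).baseChange (pullback.fst (𝒱.ι ≫ q) (𝒱.ι ≫ q))).baseChange t).hat.X.left ⟶ (((D.baseChange 𝒱.ι).baseChange (pullback.snd (𝒱.ι ≫ q) (𝒱.ι ≫ q))).baseChange t).hat.X.left),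
          (((lvl.baseChange 𝒱.ι).baseChange (pullback.fst (𝒱.ι ≫ q) (𝒱.ι ≫ q))).baseChange t).IsBaseChangeVia (((lvl.baseChange 𝒱.ι).baseChange (pullback.snd (𝒱.ι ≫ q) (𝒱.ι ≫ q))).baseChange t)
              (𝟙 (Spec (CommRingCat.of Ω))) G ∧
          (((D.baseChange 𝒱.ι).baseChange (pullback.fst (𝒱.ι ≫ q) (𝒱.ι ≫ q))).baseChange t).hat.IsBaseChangeVia (((D.baseChange 𝒱.ι).baseChange (pullback.snd (𝒱.ι ≫ q) (𝒱.ι ≫ q))).baseChange t).hat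
              (𝟙 (Spec (CommRingCat.of Ω))) Ĝ ∧
          (∃ (wG : (((𝒜.baseChange 𝒱.ι).baseChange (pullback.fst (𝒱.ι ≫ q) (𝒱.ι ≫ q))).baseChange t).X.hom ≫ 𝟙 (Spec (CommRingCat.of Ω)) =
                G ≫ (((𝒜.baseChange 𝒱.ι).baseChange (pullback.snd (𝒱.ι ≫ q) (𝒱.ι ≫ q))).baseChange t).X.hom)
              (wĜ : (((D.baseChange 𝒱.ι).baseChange (pullback.fst (𝒱.ι ≫ q) (𝒱.ι ≫ q))).baseChange t).hat.X.hom ≫ 𝟙 (Spec (CommRingCat.of Ω)) =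
                Ĝ ≫ (((D.baseChange 𝒱.ι).baseChange (pullback.snd (𝒱.ι ≫ q) (𝒱.ι ≫ q))).baseChange t).hat.X.hom),
            Nonempty ((Scheme.Modules.pullback
              (pullback.map (((𝒜.baseChange 𝒱.ι).baseChange (pullback.fst (𝒱.ι ≫ q) (𝒱.ι ≫ q))).baseChange t).X.hom (((D.baseChange 𝒱.ι).baseChange (pullback.fst (𝒱.ι ≫ q) (𝒱.ι ≫ q))).baseChange t).hat.X.hom
                (((𝒜.baseChange 𝒱.ι).baseChange (pullback.snd (𝒱.ι ≫ q) (𝒱.ι ≫ q))).baseChange t).X.hom (((D.baseChange 𝒱.ι).baseChange (pullback.snd (𝒱.ι ≫ q) (𝒱.ι ≫ q))).baseChange t).hat.X.hom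
                G Ĝ (𝟙 (Spec (CommRingCat.of Ω))) wG wĜ)).obj (((D.baseChange 𝒱.ι).baseChange (pullback.snd (𝒱.ι ≫ q) (𝒱.ι ≫ q))).baseChange t).P ≅
              (((D.baseChange 𝒱.ι).baseChange (pullback.fst (𝒱.ι ≫ q) (𝒱.ι ≫ q))).baseChange t).P)) ∧
          (((pol.baseChange 𝒱.ι).baseChange (pullback.fst (𝒱.ι ≫ q) (𝒱.ι ≫ q))).baseChange t).lam.left ≫ Ĝ = G ≫ (((pol.baseChange 𝒱.ι).baseChange (pullback.snd (𝒱.ι ≫ q) (𝒱.ι ≫ q))).baseChange t).lam.left ∧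
          ∀ a : O, (baseChangeHom (((ρ.baseChange 𝒱.ι).baseChange (pullback.fst (𝒱.ι ≫ q) (𝒱.ι ≫ q))).i a) t).left ≫ G =
            G ≫ (baseChangeHom (((ρ.baseChange 𝒱.ι).baseChange (pullback.snd (𝒱.ι ≫ q) (𝒱.ι ≫ q))).i a) t).left) ↔
        ∃ (i : Fin r) (s : Spec (CommRingCat.of Ω) ⟶ I i), s ≫ f i = t := by
  -- the graph `(1, λ)` and a rank-one frame system of `L^Δ(λ)^{⊗3}`
  let Gr : 𝒜.X.left ⟶ 𝒜.prodLeft D.hat := pullback.lift (𝟙 _) pol.lam.left (by rw [Category.id_comp]; exact (Over.w pol.lam).symm)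
  have hGr₁ : Gr ≫ pullback.fst 𝒜.X.hom D.hat.X.hom = 𝟙 _ := pullback.lift_fst _ _ _
  have hGr₂ : Gr ≫ pullback.snd 𝒜.X.hom D.hat.X.hom = pol.lam.left := pullback.lift_snd _ _ _
  have hP : HasRank ((Scheme.Modules.pullback Gr).obj D.P) 1 := hasRank_pullback Gr D.hasRank_one
  obtain ⟨F, h1⟩ := exists_frameSystem_of_hasRank (hasRank_tensorPow_one hP 3)
  exact exists_opens_isomPieces_of_frameSystem q 𝒜 ρ D pol lvl Gr hGr₁ hGr₂ F h1

end AbelianSchemeOver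

end Literature.AlgebraicGeometry.AbelianSchemes

end
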